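import Literature.MathematicalPhysics.QuantumFieldTheory.King1986.CovarianceQstarDecay
import HarnessLib

/-!
# King 1986, p. 675: Proposition 3.8 ∕ 3.9 for the TOP-SCALE row — the two-spacing rate of `(Δ^{(K)})⁻¹` and of
# `C^ηQ^*_K(x, b) = Σ_{b′} ℋ_K(x, b′)(Δ^{(K)})⁻¹(b′, b)` on Bałaban's volumes

**Citation header (reproduction of PUBLISHED and PROVED work; seat `pub-ymgap-dag-n18-b` (g2) of the cell `pub-ymgap`,
Track-A node N18 = NE5 whose PRINTED MODEL of record is King's Prop. 3.8 ∕ 3.9; sixteenth file of the seat's chain — the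
second half of the estimates for the top-scale row announced in `CovarianceQstar` ∕ `CovarianceQstarDecay`: King p. 675
«We can easily extend Proposition 3.8 to include (4.45) … Finally, Proposition 3.9 holds for G^η_{(K)} from the convergence
of C^ηQ^*_K and a_KQ_KG^η_K».)**
C. King, *The U(1) Higgs model. I. The continuum limit*, Commun. Math. Phys. **102** (1986) 649–677 [King1986], §4 p. 675
(4.44)–(4.45), (4.39)–(4.41) pp. 674–675, Lemma 4.3 p. 672; Prop. 3.8 (3.71) p. 664, Prop. 3.9 p. 665.  King's paper is
TEMPLATE LITERATURE (printed and proved `A = 0` mechanism); nothing here is about Bałaban's covariant objects.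

**What this file PROVES (kernel).**
* §1 `CdiffM` and **`effLaplacian_inv_sub_decay`**: on EVERY unit torus, `|(Δ^{(k+n)})⁻¹(b, b′) − (Δ^{(k)})⁻¹(b, b′)| ≤
  C_diff·(L^k)⁻¹·e^{−(κ_m∕2)·tdistT(b, b′)}` — King's (4.39)–(4.41) argument run for `(Δ^{(k)})⁻¹` alone: the resolvent
  identity `Δ′⁻¹ − Δ⁻¹ = Δ′⁻¹(Δ − Δ′)Δ⁻¹`, the sup rate of Lemma 4.3 in kernel form (`effLaplacian_sub_apply_le_torus`)
  interpolated against the entry decay (`CovarianceRate.abs_le_sqrt_mul_exp_half`, whence the square root and `L^{−k}`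
  instead of `L^{−2k}`, exactly as in King's (4.41)), the decay of both inverses (`effLaplacian_inv_decay`) and
  `CovarianceRate.triple_decay_bound`.
* §2 **`covQstar_row_rate`** — PROP. 3.8 FOR THE TOP-SCALE ROW on Bałaban's volumes, in the currency of
  `MinimizerBlockDecay.king_prop38_torus_blocks`: for `0 ≤ γ ≤ 1` there are `δ, c > 0` (functions of `d, L, a, m²`) with
  `|C^ηQ^*_{K,(n)}(x′, b) − C^ηQ^*_K(x, b)| ≤ (c·√((C₁′(K,n) + C₂′)·(L^K)^{−γ}) + c·(L^K)⁻¹)·e^{−δ·tdistT M (B(x)) b}` for every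
  volume, every `n ≥ 1`, every fine point `x′` over `x` — from `C^ηQ^* = ℋ·Δ_eff⁻¹` (`covQstar_kernel_eq_sum`):
  `ℋ′Δ′⁻¹ − ℋΔ⁻¹ = (ℋ′ − ℋ)Δ′⁻¹ + ℋ(Δ′⁻¹ − Δ⁻¹)`, file 8 for `ℋ′ − ℋ`, §1 for `Δ′⁻¹ − Δ⁻¹`, `exp_conv_le`.  The constants
  `C₁′ = prop38RateConst a a (lemma43Const a L K n) ((π²∕4)^d) d γ`, `C₂′ = prop38PosConst a ((π²∕4)^d) d γ` are those of
  file 8 verbatim, so the K-uniform read-out is the twin's `prop38Const_le_unif`.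

**NOT COVERED.**  The assembled `G^η_{(K)} = C^η − G^η_K` as a single kernel statement (it is `resolvent_444` read with
this file and files 8–13); Prop. 3.9's time-derivative clauses; even `L`; `A ≠ 0`.  HONEST FRAMING: King's `A = 0` scalar
MODEL — template literature on a finite torus; nothing about Bałaban's covariant objects; nothing continuum ∕ mass-gap ∕
Clay; count-neutral for the cell's 27 nodes.
-/

noncomputable section

open Finset Real Matrix
open scoped BigOperators

namespace Literature.MathematicalPhysics.QuantumFieldTheory.King1986

open Literature.MathematicalPhysics.QuantumFieldTheory.Balaban1983to89 (Params)
open Literature.MathematicalPhysics.QuantumFieldTheory.Balaban1983to89.B5Prop11Plancherel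
open Literature.MathematicalPhysics.QuantumFieldTheory.Balaban1983to89.B4Sect5Torus (IsPseudoDist SumBound)

namespace Torus

variable {d : ℕ}

/-! ## §1 The two-spacing rate of `(Δ^{(k)})⁻¹` on every unit torus -/

/-- The resolvent identity `B⁻¹ − A⁻¹ = B⁻¹(A − B)A⁻¹`. [folklore] -/
private theorem inv_sub_inv_eq' {m : Type*} [Fintype m] [DecidableEq m] (A B : Matrix m m ℝ)
    (hA : IsUnit A.det) (hB : IsUnit B.det) : B⁻¹ - A⁻¹ = B⁻¹ * (A - B) * A⁻¹ := by
  rw [Matrix.mul_sub, Matrix.sub_mul, Matrix.mul_assoc B⁻¹ A A⁻¹, Matrix.mul_nonsing_inv A hA, Matrix.mul_one,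
    Matrix.nonsing_inv_mul B hB, Matrix.one_mul]

/-- The effective Laplacian does not depend on the spelling of `N` (`L^{k+n}` versus `L^n·L^k`). [folklore] -/
private theorem effLaplacian_spelling {N N' : ℕ} [NeZero N] [NeZero N'] (h : N = N') (M' : Fin d → ℕ)
    [∀ μ, NeZero (M' μ)] (a m2 : ℝ) :
    effLaplacian N M' a (((N : ℕ) : ℝ) ^ 2) m2 = effLaplacian N' M' a (((N' : ℕ) : ℝ) ^ 2) m2 := by
  subst h; rfl

variable (d) in
/-- The constant of the two-spacing rate of `(Δ^{(k)})⁻¹`: `C_diff = (2∕γ_m)²·√(θ̄·a·2C_U)·K_d(κ_m∕2)²`.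
[cite: King1986, (4.41) p.675] -/
def CdiffM (a m2 : ℝ) (L : ℕ) : ℝ :=
  (2 / gamM a m2 L) * Real.sqrt (thetaBar a L * a * (2 * CDelU d a (aminL a L))) * (2 / gamM a m2 L)
    * Balaban1983to89.B4Sect5Proof.latticeConst d (kapM d a m2 L / 2) ^ 2

/-- `C_diff ≥ 0`. [cite: King1986, (4.41) p.675] -/
theorem CdiffM_nonneg {a m2 : ℝ} (ha : 0 < a) (hm : 0 < m2) {L : ℕ} (hL : 2 ≤ L) : 0 ≤ CdiffM d a m2 L := by
  unfold CdiffM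
  have := gamM_pos ha hm hL
  positivity

/-- **THE TWO-SPACING RATE OF `(Δ^{(k)})⁻¹`** (King's (4.39)–(4.41) for the effective Laplacian alone): for `a > 0`,
`m² > 0`, `L ≥ 2`, `k, n ≥ 1` and EVERY unit torus,
`|(Δ^{(k+n)})⁻¹(b, b′) − (Δ^{(k)})⁻¹(b, b′)| ≤ C_diff·(L^k)⁻¹·e^{−(κ_m∕2)·tdistT(b, b′)}`.
[cite: King1986, (4.39)–(4.41) pp.674–675, Lemma 4.3 p.672] -/
theorem effLaplacian_inv_sub_decay {a m2 : ℝ} (ha : 0 < a) (hm : 0 < m2) {L k n : ℕ} [NeZero L] (hL : 2 ≤ L)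
    (hk : 1 ≤ k) (hn : 1 ≤ n) (M' : Fin d → ℕ) [∀ μ, NeZero (M' μ)] (b b' : Tor M') :
    |(effLaplacian (L ^ n * L ^ k) M' (aK a L (k + n)) (((L ^ n * L ^ k : ℕ) : ℝ) ^ 2) m2)⁻¹ b b'
        - (effLaplacian (L ^ k) M' (aK a L k) (((L ^ k : ℕ) : ℝ) ^ 2) m2)⁻¹ b b'|
      ≤ CdiffM d a m2 L * ((L : ℝ) ^ k)⁻¹ * Real.exp (-(kapM d a m2 L / 2 * tdistT M' b b')) := by
  set Δ₁ := effLaplacian (L ^ k) M' (aK a L k) (((L ^ k : ℕ) : ℝ) ^ 2) m2 with hΔ₁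
  set Δ₀ := effLaplacian (L ^ n * L ^ k) M' (aK a L (k + n)) (((L ^ n * L ^ k : ℕ) : ℝ) ^ 2) m2 with hΔ₀
  set amin := aminL a L with hamin_def
  set γ := gamM a m2 L with hγ
  set κ' := kapM d a m2 L with hκ'
  set κU := kapU d a amin with hκU
  set CU := CDelU d a amin with hCU
  set Kd := Balaban1983to89.B4Sect5Proof.latticeConst d with hKd
  set ρd := tdistT M' with hρd
  have hL1r : (1 : ℝ) < L := by exact_mod_cast hL
  have hN1 : 1 ≤ L ^ k := Nat.one_le_pow k L (by omega)
  have hN0 : 1 ≤ L ^ n * L ^ k := Nat.one_le_iff_ne_zero.mpr (NeZero.ne _)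
  have hamin : 0 < amin := aminL_pos ha hL
  obtain ⟨hak1, hak2⟩ := aminL_le_aK ha hL hk
  obtain ⟨hakn1, hakn2⟩ := aminL_le_aK ha hL (show 1 ≤ k + n by omega)
  have haK : 0 < aK a L k := lt_of_lt_of_le hamin hak1
  have haKn : 0 < aK a L (k + n) := lt_of_lt_of_le hamin hakn1
  have hγpos : 0 < γ := gamM_pos ha hm hL
  obtain ⟨hκU0, _⟩ := kapU_pos_le (d := d) ha hamin
  have hCU0 : 0 < CU := CDelU_pos ha hamin
  obtain ⟨hκ'0, hκ'U⟩ := kapM_pos_le (d := d) ha hm hL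
  have hpd : IsPseudoDist ρd := tdistT_isPseudoDist M'
  have hSB : SumBound ρd Kd := tdistT_sumBound M'
  -- resolvent identity
  have hu1 := (Matrix.isUnit_iff_isUnit_det _).mp (effLaplacian_isUnit (L ^ k) M' hN1 haK hm)
  have hu0 : IsUnit Δ₀.det := by
    have h := effLaplacian_isUnit (L ^ n * L ^ k) M' hN0 haKn hm
    exact (Matrix.isUnit_iff_isUnit_det _).mp h
  have hres : Δ₀⁻¹ - Δ₁⁻¹ = Δ₀⁻¹ * (Δ₁ - Δ₀) * Δ₁⁻¹ := inv_sub_inv_eq' Δ₁ Δ₀ hu1 hu0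
  -- decay of the two inverses at rate κ′
  have hK1 : ∀ z w, |Δ₁⁻¹ z w| ≤ (2 / γ) * Real.exp (-(κ' * ρd z w)) := fun z w =>
    effLaplacian_inv_decay ha hm hL hk M' z w
  have hK0 : ∀ z w, |Δ₀⁻¹ z w| ≤ (2 / γ) * Real.exp (-(κ' * ρd z w)) := fun z w => by
    have h := effLaplacian_inv_decay (d := d) ha hm hL (show 1 ≤ k + n by omega) M' z w
    rwa [effLaplacian_spelling (show L ^ (k + n) = L ^ n * L ^ k by rw [pow_add, mul_comm]) M'
      (aK a L (k + n)) m2] at h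
  -- the middle factor: sup rate (Lemma 4.3) interpolated against the entry decay
  have hε0 : 0 ≤ thetaK a L k n * a := by
    have : 0 < aK a L n := lt_of_lt_of_le hamin (aminL_le_aK ha hL hn).1
    unfold thetaK; positivity
  have hEsup : ∀ z w, |(Δ₁ - Δ₀) z w| ≤ thetaK a L k n * a := fun z w => by
    rw [Matrix.sub_apply, abs_sub_comm]
    exact effLaplacian_sub_apply_le_torus ha hm hL hk hn M' z w
  have hEdec : ∀ z w, |(Δ₁ - Δ₀) z w| ≤ (2 * CU) * Real.exp (-(κU * ρd z w)) := fun z w => by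
    rw [Matrix.sub_apply]
    have h1 : |Δ₁ z w| ≤ CU * Real.exp (-(κU * ρd z w)) :=
      effLaplacian_entry_le_unif ha hamin hak1 hak2 hm (L ^ k) M' z w
    have h0 : |Δ₀ z w| ≤ CU * Real.exp (-(κU * ρd z w)) :=
      effLaplacian_entry_le_unif ha hamin hakn1 hakn2 hm (L ^ n * L ^ k) M' z w
    calc |Δ₁ z w - Δ₀ z w| ≤ |Δ₁ z w| + |Δ₀ z w| := abs_sub _ _
      _ ≤ _ := by linarith
  have hE : ∀ z w, |(Δ₁ - Δ₀) z w|
      ≤ Real.sqrt (thetaK a L k n * a * (2 * CU)) * Real.exp (-(κ' * ρd z w)) := fun z w => by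
    have h := abs_le_sqrt_mul_exp_half hε0 (hEsup z w) (hEdec z w)
    refine h.trans (exp_decay_mono (Real.sqrt_nonneg _) ?_ (hpd.nonneg z w))
    linarith
  -- lattice sums at rate κ′/2 and the triple bound
  have hV : ∀ z, ∑ w, Real.exp (-(κ' / 2 * ρd z w)) ≤ Kd (κ' / 2) := fun z => hSB (κ' / 2) (by positivity) z
  have h3 := triple_decay_bound ρd hpd.nonneg hpd.triangle Δ₀⁻¹ (Δ₁ - Δ₀) Δ₁⁻¹ hκ'0.le (by positivity)
    (Real.sqrt_nonneg _) hK0 hE hK1 hV b b'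
  rw [← hres, Matrix.sub_apply] at h3
  refine h3.trans ?_
  -- constants: √(θ_k a 2C_U) ≤ √(θ̄ a 2C_U)·L^{−k}
  have hθ : thetaK a L k n * a * (2 * CU) ≤ thetaBar a L * a * (2 * CU) * (((L : ℝ) ^ k) ^ 2)⁻¹ := by
    have := thetaK_le ha hL hk hn
    have h2CU : 0 ≤ a * (2 * CU) := by positivity
    calc thetaK a L k n * a * (2 * CU) = thetaK a L k n * (a * (2 * CU)) := by ring
      _ ≤ thetaBar a L * (((L : ℝ) ^ k) ^ 2)⁻¹ * (a * (2 * CU)) := mul_le_mul_of_nonneg_right this h2CU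
      _ = _ := by ring
  have hLk : (0 : ℝ) < (L : ℝ) ^ k := by positivity
  have hsqrt : Real.sqrt (thetaK a L k n * a * (2 * CU))
      ≤ Real.sqrt (thetaBar a L * a * (2 * CU)) * ((L : ℝ) ^ k)⁻¹ := by
    calc Real.sqrt (thetaK a L k n * a * (2 * CU))
        ≤ Real.sqrt (thetaBar a L * a * (2 * CU) * (((L : ℝ) ^ k) ^ 2)⁻¹) := Real.sqrt_le_sqrt hθ
      _ = Real.sqrt (thetaBar a L * a * (2 * CU)) * Real.sqrt ((((L : ℝ) ^ k) ^ 2)⁻¹) :=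
          Real.sqrt_mul' _ (by positivity)
      _ = Real.sqrt (thetaBar a L * a * (2 * CU)) * ((L : ℝ) ^ k)⁻¹ := by
          rw [Real.sqrt_inv, Real.sqrt_sq hLk.le]
  have hVnn : 0 ≤ Kd (κ' / 2) := latticeConst_profile_nonneg d _ (by positivity)
  have e : CdiffM d a m2 L * ((L : ℝ) ^ k)⁻¹ * Real.exp (-(kapM d a m2 L / 2 * tdistT M' b b'))
      = 2 / γ * (Real.sqrt (thetaBar a L * a * (2 * CU)) * ((L : ℝ) ^ k)⁻¹) * (2 / γ) * Kd (κ' / 2) ^ 2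
        * Real.exp (-(κ' / 2 * ρd b b')) := by
    simp only [CdiffM, hCU, hκ', hγ, hρd, hamin_def, hKd]
    ring
  rw [e]
  have hγ2 : 0 ≤ 2 / γ := by positivity
  gcongr

/-! ## §2 Proposition 3.8 for the top-scale row `C^ηQ^*_K` on Bałaban's volumes -/

/-- **PROPOSITION 3.8 FOR THE TOP-SCALE ROW `C^ηQ^*_K` ON BAŁABAN'S VOLUMES** («We can easily extend Proposition 3.8 to
include (4.45)», p. 675), in the currency of `king_prop38_torus_blocks`: for `d ≥ 1`, odd `L ≥ 2`, `a > 0`, `m² > 0`,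
`0 ≤ γ ≤ 1` there are `δ, c > 0` (functions of `d, L, a, m²`) such that for every volume `(d, L, m, K)`, `K ≥ 1`, every
`n ≥ 1`, the unit torus `M_μ = 2L^m`, every fine point `x′` of the `L^{K+n}`-lattice over the fine point `x` of the
`L^K`-lattice and every unit site `b`:
`|C^ηQ^*_{K,(n)}(x′, b) − C^ηQ^*_K(x, b)| ≤ (c·√((C₁′ + C₂′)(L^K)^{−γ}) + c·(L^K)⁻¹)·exp(−δ·tdistT M (B(x)) b)` with file 8's
`C₁′ = prop38RateConst a a (lemma43Const a L K n) ((π²∕4)^d) d γ`, `C₂′ = prop38PosConst a ((π²∕4)^d) d γ`.  Route: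
`C^ηQ^* = ℋ·Δ_eff⁻¹` (`covQstar_kernel_eq_sum`), `ℋ′Δ′⁻¹ − ℋΔ⁻¹ = (ℋ′ − ℋ)Δ′⁻¹ + ℋ(Δ′⁻¹ − Δ⁻¹)`, file 8 for `ℋ′ − ℋ` and
`ℋ`, `effLaplacian_inv_decay` ∕ `effLaplacian_inv_sub_decay` for the unit-lattice factors, `exp_conv_le`.
[cite: King1986, (4.45) p.675, Prop. 3.8 (3.71) p.664] -/
theorem covQstar_row_rate (dd L : ℕ) (hd : 1 ≤ dd) (hLodd : Odd L) (hL : 2 ≤ L) {a m2 : ℝ} (ha : 0 < a)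
    (hm : 0 < m2) {γ : ℝ} (hγ0 : 0 ≤ γ) (hγ1 : γ ≤ 1) :
    ∃ δ c : ℝ, 0 < δ ∧ 0 < c ∧ ∀ (P : Params) (_hPd : P.d = dd) (_hPL : P.L = L) (_hK : 1 ≤ P.K) [NeZero P.L]
      (n : ℕ) (_hn : 1 ≤ n) (M : Fin P.d → ℕ) [∀ μ, NeZero (M μ)] (_hMK : ∀ μ, M μ = P.sitesPerDir P.K)
      (xt : Tor (fine (P.L ^ P.K) M)) (xt' : Tor (fine (P.L ^ n * P.L ^ P.K) M)) (bt : Tor M)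
      (_hxx : ∀ μ, (xt μ).val = (xt' μ).val / P.L ^ n),
      |covQstar (P.L ^ n * P.L ^ P.K) M (((P.L ^ n * P.L ^ P.K : ℕ) : ℝ) ^ 2) m2 (Pi.single bt 1) xt'
          - covQstar (P.L ^ P.K) M (((P.L ^ P.K : ℕ) : ℝ) ^ 2) m2 (Pi.single bt 1) xt|
        ≤ (c * Real.sqrt ((prop38RateConst a a (lemma43Const a P.L P.K n) ((π ^ 2 / 4) ^ P.d) P.d γ
                + prop38PosConst a ((π ^ 2 / 4) ^ P.d) P.d γ) * ((P.L ^ P.K : ℕ) : ℝ) ^ (-γ))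
            + c * ((P.L : ℝ) ^ P.K)⁻¹)
          * Real.exp (-(δ * tdistT M (blockOf (P.L ^ P.K) M xt) bt)) := by
  have hL1 : 1 < L := by omega
  obtain ⟨δ₀, c₀, hδ₀, hc₀, Hdec⟩ := minimiser_kernel_decay_blocks dd L hd ⟨hLodd, hL1⟩ ha hm.le
  obtain ⟨δ₁, c₁, hδ₁, hc₁, Hrate⟩ := king_prop38_torus_blocks dd L hd hLodd hL ha hm hγ0 hγ1
  set κm := kapM dd a m2 L with hκm
  set γm := gamM a m2 L with hγm
  set Cd := CdiffM dd a m2 L with hCd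
  obtain ⟨hκm0, _⟩ := kapM_pos_le (d := dd) ha hm hL
  have hγm0 : 0 < γm := gamM_pos ha hm hL
  have hCd0 : 0 ≤ Cd := CdiffM_nonneg ha hm hL
  -- common rate
  set δ : ℝ := min (min δ₀ (δ₁ / 2)) (κm / 2) / 2 with hδdef
  have hmin : 0 < min (min δ₀ (δ₁ / 2)) (κm / 2) := lt_min (lt_min hδ₀ (half_pos hδ₁)) (half_pos hκm0)
  have hδ0 : 0 < δ := by rw [hδdef]; exact half_pos hmin
  have hδA : 2 * δ ≤ δ₀ := by
    rw [hδdef]; linarith [min_le_left (min δ₀ (δ₁ / 2)) (κm / 2), min_le_left δ₀ (δ₁ / 2)]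
  have hδB : 2 * δ ≤ δ₁ / 2 := by
    rw [hδdef]; linarith [min_le_left (min δ₀ (δ₁ / 2)) (κm / 2), min_le_right δ₀ (δ₁ / 2)]
  have hδC : 2 * δ ≤ κm := by rw [hδdef]; linarith [min_le_right (min δ₀ (δ₁ / 2)) (κm / 2)]
  have hδD : 2 * δ ≤ κm / 2 := by rw [hδdef]; linarith [min_le_right (min δ₀ (δ₁ / 2)) (κm / 2)]
  set Kd := Balaban1983to89.B4Sect5Proof.latticeConst dd with hKd
  have hKdδ : 0 ≤ Kd δ := latticeConst_profile_nonneg dd δ hδ0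
  -- the constant
  set c : ℝ := (2 / γm) * Real.sqrt (2 * (a * c₁)) * Kd δ + Cd * (a * c₀) * Kd δ + 1 with hcdef
  have hcA : (2 / γm) * Real.sqrt (2 * (a * c₁)) * Kd δ ≤ c := by
    rw [hcdef]; have : 0 ≤ Cd * (a * c₀) * Kd δ := by positivity
    linarith
  have hcB : Cd * (a * c₀) * Kd δ ≤ c := by
    rw [hcdef]; have : 0 ≤ (2 / γm) * Real.sqrt (2 * (a * c₁)) * Kd δ := by positivity
    linarith
  refine ⟨δ, c, hδ0, by positivity, ?_⟩
  intro P hPd hPL hK _ n hn M _ hMK xt xt' bt hxx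
  have hLr : (1 : ℝ) < P.L := by exact_mod_cast P.hL.2
  have hPL2 : 2 ≤ P.L := by have := P.hL.2; omega
  have hN1 : 1 ≤ P.L ^ P.K := Nat.one_le_pow _ _ (by have := P.hL.2; omega)
  have hN0 : 1 ≤ P.L ^ n * P.L ^ P.K := Nat.one_le_iff_ne_zero.mpr (NeZero.ne _)
  have haK : 0 < aK a P.L P.K := aK_pos ha hLr hK
  have haKn : 0 < aK a P.L (P.K + n) := aK_pos ha hLr (by omega)
  -- names
  set ΔA := effLaplacian (P.L ^ P.K) M (aK a P.L P.K) (((P.L ^ P.K : ℕ) : ℝ) ^ 2) m2 with hΔA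
  set ΔB := effLaplacian (P.L ^ n * P.L ^ P.K) M (aK a P.L (P.K + n)) (((P.L ^ n * P.L ^ P.K : ℕ) : ℝ) ^ 2) m2
    with hΔB
  set HA : Tor M → ℝ := fun b' =>
    minimiser (P.L ^ P.K) M (aK a P.L P.K) (((P.L ^ P.K : ℕ) : ℝ) ^ 2) m2 (Pi.single b' 1) xt with hHA
  set HB : Tor M → ℝ := fun b' =>
    minimiser (P.L ^ n * P.L ^ P.K) M (aK a P.L (P.K + n)) (((P.L ^ n * P.L ^ P.K : ℕ) : ℝ) ^ 2) m2
      (Pi.single b' 1) xt' with hHB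
  set X : ℝ := (prop38RateConst a a (lemma43Const a P.L P.K n) ((π ^ 2 / 4) ^ P.d) P.d γ
      + prop38PosConst a ((π ^ 2 / 4) ^ P.d) P.d γ) * ((P.L ^ P.K : ℕ) : ℝ) ^ (-γ) with hX
  set D : ℝ := tdistT M (blockOf (P.L ^ P.K) M xt) bt with hD
  -- kernel forms
  rw [covQstar_kernel_eq_sum (P.L ^ n * P.L ^ P.K) M hN0 haKn hm bt xt',
    covQstar_kernel_eq_sum (P.L ^ P.K) M hN1 haK hm bt xt, ← Finset.sum_sub_distrib]
  -- the four inputs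
  have hKB : ∀ b', |ΔB⁻¹ b' bt| ≤ (2 / γm) * Real.exp (-(κm * tdistT M b' bt)) := fun b' => by
    have h := effLaplacian_inv_decay (d := P.d) ha hm hPL2 (show 1 ≤ P.K + n by omega) M b' bt
    rw [effLaplacian_spelling (show P.L ^ (P.K + n) = P.L ^ n * P.L ^ P.K by rw [pow_add, mul_comm]) M
      (aK a P.L (P.K + n)) m2] at h
    have e1 : gamM a m2 P.L = γm := by rw [hγm, hPL]
    have e2 : kapM P.d a m2 P.L = κm := by rw [hκm, hPL, hPd]
    rw [e1, e2] at h
    exact h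
  have hKdiff : ∀ b', |ΔB⁻¹ b' bt - ΔA⁻¹ b' bt|
      ≤ Cd * ((P.L : ℝ) ^ P.K)⁻¹ * Real.exp (-(κm / 2 * tdistT M b' bt)) := fun b' => by
    have h := effLaplacian_inv_sub_decay (d := P.d) ha hm hPL2 hK hn M b' bt
    have e1 : CdiffM P.d a m2 P.L = Cd := by rw [hCd, hPL, hPd]
    have e2 : kapM P.d a m2 P.L = κm := by rw [hκm, hPL, hPd]
    rw [e1, e2] at h
    exact h
  have hHA : ∀ b', |HA b'| ≤ a * c₀ * Real.exp (-(δ₀ * tdistT M (blockOf (P.L ^ P.K) M xt) b')) := fun b' =>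
    (Hdec P hPd hPL hK M hMK (P.L ^ P.K) rfl xt b').trans
      (mul_le_mul_of_nonneg_right (mul_le_mul_of_nonneg_right (aK_le ha hLr hK) hc₀.le) (Real.exp_pos _).le)
  have hHdiff : ∀ b', |HB b' - HA b'|
      ≤ Real.sqrt (X * (2 * (a * c₁))) * Real.exp (-(δ₁ / 2 * tdistT M (blockOf (P.L ^ P.K) M xt) b')) :=
    fun b' => Hrate P hPd hPL hK n hn M hMK xt xt' b' hxx
  -- termwise split
  have hpd : IsPseudoDist (tdistT M) := tdistT_isPseudoDist M
  have hterm : ∀ b', |ΔB⁻¹ b' bt * HB b' - ΔA⁻¹ b' bt * HA b'|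
      ≤ (2 / γm) * Real.sqrt (X * (2 * (a * c₁)))
          * (Real.exp (-(δ₁ / 2 * tdistT M (blockOf (P.L ^ P.K) M xt) b')) * Real.exp (-(κm * tdistT M b' bt)))
        + Cd * ((P.L : ℝ) ^ P.K)⁻¹ * (a * c₀)
          * (Real.exp (-(δ₀ * tdistT M (blockOf (P.L ^ P.K) M xt) b'))
              * Real.exp (-(κm / 2 * tdistT M b' bt))) := by
    intro b'
    have e : ΔB⁻¹ b' bt * HB b' - ΔA⁻¹ b' bt * HA b'
        = ΔB⁻¹ b' bt * (HB b' - HA b') + (ΔB⁻¹ b' bt - ΔA⁻¹ b' bt) * HA b' := by ring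
    rw [e]
    refine (abs_add_le _ _).trans (add_le_add ?_ ?_)
    · rw [abs_mul]
      calc |ΔB⁻¹ b' bt| * |HB b' - HA b'|
          ≤ ((2 / γm) * Real.exp (-(κm * tdistT M b' bt)))
            * (Real.sqrt (X * (2 * (a * c₁))) * Real.exp (-(δ₁ / 2 * tdistT M (blockOf (P.L ^ P.K) M xt) b'))) :=
            mul_le_mul (hKB b') (hHdiff b') (abs_nonneg _) (by positivity)
        _ = _ := by ring
    · rw [abs_mul]
      calc |ΔB⁻¹ b' bt - ΔA⁻¹ b' bt| * |HA b'|
          ≤ (Cd * ((P.L : ℝ) ^ P.K)⁻¹ * Real.exp (-(κm / 2 * tdistT M b' bt)))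
            * (a * c₀ * Real.exp (-(δ₀ * tdistT M (blockOf (P.L ^ P.K) M xt) b'))) :=
            mul_le_mul (hKdiff b') (hHA b') (abs_nonneg _) (by positivity)
        _ = _ := by ring
  -- the two convolutions
  have hconv1 := exp_conv_le hpd (tdistT_sumBound M) (κ₁ := δ₁ / 2) (κ₂ := κm) hδ0 hδB hδC
    (blockOf (P.L ^ P.K) M xt) bt
  have hconv2 := exp_conv_le hpd (tdistT_sumBound M) (κ₁ := δ₀) (κ₂ := κm / 2) hδ0 hδA hδD
    (blockOf (P.L ^ P.K) M xt) bt
  have hK' : Balaban1983to89.B4Sect5Proof.latticeConst P.d δ = Kd δ := by rw [hKd, hPd]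
  rw [hK'] at hconv1 hconv2
  have hsqrt : Real.sqrt (X * (2 * (a * c₁))) = Real.sqrt X * Real.sqrt (2 * (a * c₁)) :=
    Real.sqrt_mul' _ (by positivity)
  have hLKnat : (((P.L ^ P.K : ℕ) : ℝ)) = (P.L : ℝ) ^ P.K := by push_cast; ring
  calc |∑ b' : Tor M, (ΔB⁻¹ b' bt * HB b' - ΔA⁻¹ b' bt * HA b')|
      ≤ ∑ b' : Tor M, |ΔB⁻¹ b' bt * HB b' - ΔA⁻¹ b' bt * HA b'| := Finset.abs_sum_le_sum_abs _ _
    _ ≤ ∑ b' : Tor M, ((2 / γm) * Real.sqrt (X * (2 * (a * c₁)))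
          * (Real.exp (-(δ₁ / 2 * tdistT M (blockOf (P.L ^ P.K) M xt) b')) * Real.exp (-(κm * tdistT M b' bt)))
        + Cd * ((P.L : ℝ) ^ P.K)⁻¹ * (a * c₀)
          * (Real.exp (-(δ₀ * tdistT M (blockOf (P.L ^ P.K) M xt) b'))
              * Real.exp (-(κm / 2 * tdistT M b' bt)))) := Finset.sum_le_sum fun b' _ => hterm b'
    _ = (2 / γm) * Real.sqrt (X * (2 * (a * c₁)))
          * ∑ b' : Tor M, Real.exp (-(δ₁ / 2 * tdistT M (blockOf (P.L ^ P.K) M xt) b'))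
              * Real.exp (-(κm * tdistT M b' bt))
        + Cd * ((P.L : ℝ) ^ P.K)⁻¹ * (a * c₀)
          * ∑ b' : Tor M, Real.exp (-(δ₀ * tdistT M (blockOf (P.L ^ P.K) M xt) b'))
              * Real.exp (-(κm / 2 * tdistT M b' bt)) := by
        rw [Finset.sum_add_distrib, Finset.mul_sum, Finset.mul_sum]
    _ ≤ (2 / γm) * Real.sqrt (X * (2 * (a * c₁))) * (Kd δ * Real.exp (-(δ * D)))
        + Cd * ((P.L : ℝ) ^ P.K)⁻¹ * (a * c₀) * (Kd δ * Real.exp (-(δ * D))) :=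
        add_le_add (mul_le_mul_of_nonneg_left hconv1 (by positivity))
          (mul_le_mul_of_nonneg_left hconv2 (by positivity))
    _ = (((2 / γm) * Real.sqrt (2 * (a * c₁)) * Kd δ) * Real.sqrt X
          + (Cd * (a * c₀) * Kd δ) * ((P.L : ℝ) ^ P.K)⁻¹) * Real.exp (-(δ * D)) := by
        rw [hsqrt]; ring
    _ ≤ (c * Real.sqrt X + c * ((P.L : ℝ) ^ P.K)⁻¹) * Real.exp (-(δ * D)) := by
        refine mul_le_mul_of_nonneg_right (add_le_add ?_ ?_) (Real.exp_pos _).le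
        · exact mul_le_mul_of_nonneg_right hcA (Real.sqrt_nonneg _)
        · exact mul_le_mul_of_nonneg_right hcB (by positivity)

end Torus

end Literature.MathematicalPhysics.QuantumFieldTheory.King1986
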